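import Literature.Analysis.FluidPDE.SuitableWeak
import Literature.Analysis.FluidPDE.AxisymmetricEuler
import HarnessLib

/-!
# Barrier: axisymmetric singularities cannot be of Type I
(Seregin–Šverák 2009; Koch–Nadirashvili–Seregin–Šverák 2009; Chen–Strain–Tsai–Yau 2008/2009)

Barrier catalogue entry for `NavierStokesRegularity` (D-0021), on the NEGATIVE side (routes aiming
at `¬ NavierStokesRegularity` through an axisymmetric blow-up scenario). Vendors, as a named fact,
the LOCAL form of the result printed as Theorem 3.1 (= Theorem 1.1) of G. Seregin, V. Šverák,
*On Type I singularities of the local axi-symmetric solutions of the Navier–Stokes equations*,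
Comm. PDE 34 (2009), 171–201 (arXiv:0804.1803), over the accepted vocabulary
`Literature.Analysis.FluidPDE.IsDistributionalNSSolutionOn`, `Literature.Analysis.FluidPDE.IsAxisymmetric`, `Literature.Analysis.FluidPDE.cylRadius`,
`Literature.Analysis.FluidPDE.parabolicCylinder`.

The in-tree `Literature.Analysis.FluidPDE.knss_no_axisymmetric_typeI` (`Literature/Analysis/FluidPDE/Axisymmetric.lean`)
is a global-in-space rendering of the companion results KNSS 2009, Thms. 6.1–6.2; it is not
restated here (its docstring attributes the Type I bound to Thm. 6.1 and the `C/r` bound to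
Thm. 6.2 — in print it is the other way round, and Thm. 6.2 carries an extra spatial-decay
hypothesis (its (assumption2))). The present file states the local theorem exactly, which needs
no decay hypothesis.

## What is printed (Seregin–Šverák 2009)

* Setting of §3: `Q = 𝒞 × ]-1, 0[`, `𝒞 = {x = (x', x₃) : |x'| < 1, |x₃| < 1}` the unit spatial
  cylinder of `ℝ³`; a pair `v ∈ L³(Q)`, `q ∈ L_{3/2}(Q)` satisfying the Navier–Stokes system
  (`ν = 1`) in `Q` in the sense of distributions; `v` is *regular at `z = 0`* if `v` is
  essentially bounded in `Q(r) = 𝒞(r) × ]-r², 0[` for some `r > 0`.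
* Thm. 3.1 (= Thm. 1.1): assume moreover that `v` is axially symmetric and
  `|v(x,t)| ≤ C / √(-t)` for almost all `z = (x,t) ∈ Q` (their (1.2)/(3.x): the weakened, not
  necessarily small, form of the scale-invariant quantity `sup √(t₀-t)|v|`). Then `z = 0` is a
  regular point of `v`. (Thm. 1.1 even allows the bound on the meridional part `v̄` only.)
* Thm. 1.2: the same under `|v| ≤ C/|x'|` plus essential boundedness away from `t = 0`;
  Thm. 1.3: no swirl.
* §1: "every potential singularity of an axi-symmetric solution has to be of type II"; the proof
  rescales at the putative singularity to a bounded ancient MILD solution and applies the KNSS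
  Liouville theorems (KNSS 2009, Thms. 5.1–5.3).

## Rendering

Hypotheses are those of the tree's `IsDistributionalNSSolutionOn` (pressure-explicit
distributional solution, which implies the pressure-free weak form of SS Def. 2.1) on the open
set `Q`, plus `v ∈ L³(Q)`, `q ∈ L^{3/2}(Q)`, POINTWISE axisymmetry of every slice (stronger than
axial symmetry of the `L³` class, hence harmless), and the a.e. Type I bound. The conclusion is
essential boundedness on the parabolic cylinder `(-r², 0) × B_r(0) ⊆ Q(r)` for some `r > 0`
(one-sided in time: the values of `u` for `t ≥ 0` are not constrained by the hypotheses, so the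
tree's two-sided `Fluid.IsRegularPoint` is deliberately not used).

## Formal status (trust base of the barrier, 2026-08-15)

`AxisymmetricTypeIExclusion` remains a NAMED FACT (size XL). Its printed architecture is in the
tree: `Literature/Analysis/FluidPDE/SereginSverakAxisymmetric.lean` (SS 2009, §3 vocabulary,
Lemma 3.5 `ScaledEnergyBound`, Prop. 3.7 `AxisDecayBound`, Remark 3.4), its siblings
`SereginSverakAxisymmetricProofs.lean` (Prop. 3.7 PROVED from Lemma 3.5 and the off-axis bound
`OffAxisBound` of Seregin–Zajaczkowski 2007), `SereginSverakBlowup.lean` (the Type I blow-up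
step `BlowupAlternativeTypeI` of §4 and its inputs) and `SereginSverakAxisDecay.lean`
(Lemma 3.6 with its uniformity and the `C/|x'|` variant, SS Thm. 3.2, assembled conditionally as
`SereginSverak2009.isRegularAtOrigin_of_axisDecay`), and the companion
`AxisymmetricTypeIExclusionProofs.lean` PROVES the barrier from the current leaves:
`axisymmetricTypeIExclusion_of_leaves : ScaledEnergyBound → OffAxisBound →
BlowupAlternativeTypeI → KNSS2009_liouville_bound_C_over_r → AxisymmetricTypeIExclusion`
(KNSS 2009, Thm. 5.3 being `Literature.Analysis.FluidPDE.KNSS2009_liouville_bound_C_over_r`).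
Discharging those four named facts discharges the barrier.

## References

* G. Seregin, V. Šverák, Comm. PDE 34 (2009), 171–201. [`SereginSverak2009`]
* G. Koch, N. Nadirashvili, G. Seregin, V. Šverák, Acta Math. 203 (2009), 83–105.
  [`KochNadirashviliSereginSverak2009`]
* C.-C. Chen, R. Strain, T.-P. Tsai, H.-T. Yau, IMRN 2008 and Comm. PDE 34 (2009).
  [`ChenStrainYauTsai2008`, `ChenStrainTsaiYau2009`]
* T. Y. Hou, Found. Comput. Math. 23 (2023). [`Hou2022PotentiallySingularNS`]
* T. Tao, J. Amer. Math. Soc. 29 (2016) (Type II character of the averaged blow-up).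
  [`Tao2016AveragedNS`]
-/

noncomputable section

open MeasureTheory Set Function TopologicalSpace
open scoped ENNReal

namespace Literature.Barriers.NavierStokesRegularity

/-- Local notation for physical space `ℝ³ = EuclideanSpace ℝ (Fin 3)`. -/
local notation "ℝ³" => EuclideanSpace ℝ (Fin 3)

/-- The Seregin–Šverák unit space–time cylinder `Q = 𝒞 × ]-1, 0[` as a subset of `ℝ × ℝ³`
(time first): `-1 < t < 0`, `|x'| < 1`, `|x₃| < 1` (Seregin–Šverák 2009, §3).
[cite: SereginSverak2009, §3] -/
def ssCylinder : Set (ℝ × ℝ³) :=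
  {z | z.1 ∈ Ioo (-1 : ℝ) 0 ∧ Literature.Analysis.FluidPDE.cylRadius z.2 < 1 ∧ |z.2 2| < 1}

/-- Membership in the Seregin–Šverák cylinder, unfolded. [cite: SereginSverak2009, §3] -/
theorem mem_ssCylinder {z : ℝ × ℝ³} :
    z ∈ ssCylinder ↔ z.1 ∈ Ioo (-1 : ℝ) 0 ∧ Literature.Analysis.FluidPDE.cylRadius z.2 < 1 ∧ |z.2 2| < 1 :=
  Iff.rfl

/-- The Seregin–Šverák cylinder is open (preimages of open sets under continuous maps).
[folklore] -/
theorem isOpen_ssCylinder : IsOpen ssCylinder := by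
  have h1 : Continuous fun z : ℝ × ℝ³ => z.1 := continuous_fst
  have h2 : Continuous fun z : ℝ × ℝ³ => Literature.Analysis.FluidPDE.cylRadius z.2 := by
    unfold Literature.Analysis.FluidPDE.cylRadius
    fun_prop
  have h3 : Continuous fun z : ℝ × ℝ³ => |z.2 2| := by fun_prop
  have h : ssCylinder = (fun z : ℝ × ℝ³ => z.1) ⁻¹' Ioo (-1 : ℝ) 0 ∩
      ((fun z : ℝ × ℝ³ => Literature.Analysis.FluidPDE.cylRadius z.2) ⁻¹' Iio 1 ∩ (fun z : ℝ × ℝ³ => |z.2 2|) ⁻¹' Iio 1) := by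
    ext z
    simp [ssCylinder]
  rw [h]
  exact (isOpen_Ioo.preimage h1).inter ((isOpen_Iio.preimage h2).inter (isOpen_Iio.preimage h3))

/-- The Seregin–Šverák cylinder as an element of `Opens (ℝ × ℝ³)`, the domain of the accepted
`Literature.Analysis.FluidPDE.IsDistributionalNSSolutionOn`. [cite: SereginSverak2009, §3] -/
def ssCylinderOpens : Opens (ℝ × ℝ³) :=
  ⟨ssCylinder, isOpen_ssCylinder⟩

/-- Underlying set of `ssCylinderOpens`. [folklore] -/
@[simp]
theorem coe_ssCylinderOpens : ((ssCylinderOpens : Opens (ℝ × ℝ³)) : Set (ℝ × ℝ³)) = ssCylinder :=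
  rfl

/-- **Barrier (Seregin–Šverák 2009, Thm. 3.1 = Thm. 1.1; KNSS 2009): an axisymmetric
Navier–Stokes singularity cannot be of Type I.** Let `(u, p)` solve the Navier–Stokes system
(`ν = 1`, no force) in the sense of distributions in the unit cylinder
`Q = 𝒞 × ]-1,0[` (accepted `Literature.Analysis.FluidPDE.IsDistributionalNSSolutionOn` on `ssCylinderOpens`), with
`u ∈ L³(Q)`, `p ∈ L^{3/2}(Q)`, every slice `u(t)`, `-1 < t < 0`, axisymmetric about the
`x₃`-axis, and the Type I bound `|u(x,t)| ≤ C/√(-t)` for a.e. `(t,x) ∈ Q`. Then the space–time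
origin is a regular point: `u` is essentially bounded on `]-r², 0[ × B_r(0)` for some `r > 0`.
[cite: SereginSverak2009, Thm. 3.1 (= Thm. 1.1) and §3]

BARRIER (structured block, D-0021):
technique_class: axisymmetric-blowup-scenario type-I-blowup-rate self-similar-rate-singularity axisymmetric-numerics
blocks: the negation ¬NavierStokesRegularity via ANY axisymmetric singularity (with or without swirl) obeying the scale-invariant rate `|u| ≤ C(T-t)^{-1/2}` — `C` arbitrarily large — near the blow-up point, e.g. exactly or discretely self-similar axisymmetric profiles: such a point is regular [cite: SereginSverak2009, Thm. 3.1 (= Thm. 1.1)]; likewise under `|u| ≤ C/|x'|` [cite: SereginSverak2009, Thm. 1.2] [cite: KochNadirashviliSereginSverak2009, Thm. 6.1], under `|u| ≤ C_*(r² - t)^{-1/2}` [cite: ChenStrainYauTsai2008, main theorem as reported in Chen–Strain–Tsai–Yau 2009 §1] and `|u| ≤ C_* r^{-1+ε}|t|^{-ε/2}`, `0 ≤ ε ≤ 1` [cite: ChenStrainTsaiYau2009, Thm. 1.1]; "every potential singularity of an axi-symmetric solution has to be of type II" [cite: KochNadirashviliSereginSverak2009, §1].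
because: rescaling at a putative Type I singular point produces a nonzero bounded ancient MILD solution inheriting axisymmetry and the scale-invariant bound; the KNSS Liouville theorems (2-D; axisymmetric no swirl; axisymmetric with `|u| ≤ C/|x'|`) force it to be constant/zero, contradicting `|v(0,0)| = 1` [cite: KochNadirashviliSereginSverak2009, Thms. 5.1–5.3, Prop. 6.1 and §6] [cite: SereginSverak2009, §1–§2, Thm. 2.8].
evasions_known: Type II (faster than self-similar rate) axisymmetric scenarios are not excluded — the general Liouville conjecture for bounded ancient mild solutions is open [cite: KochNadirashviliSereginSverak2009, §1] [cite: SereginSverak2009, §1 Conjecture (L)]; the numerically proposed axisymmetric candidate is "nearly" (not exactly) self-similar [cite: Hou2022PotentiallySingularNS, §1]; non-axisymmetric Type I scenarios are untouched by these theorems, and Tao's averaged-equation blow-up is Type II [cite: Tao2016AveragedNS, §1.1 p. 8].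
scope_caveats: (a) the FORMAL declaration is the local Thm. 3.1 only: axisymmetric (pointwise, every slice) distributional solutions in the unit cylinder `Q = 𝒞 × ]-1,0[` with `u ∈ L³(Q)`, `p ∈ L^{3/2}(Q)` and the a.e. bound `|u| ≤ C/√(-t)`; the variants under `|u| ≤ C/|x'|`, `|u| ≤ C_*(r² - t)^{-1/2}` and `C_* r^{-1+ε}|t|^{-ε/2}` named in `blocks:` are print-only in this file [cite: SereginSverak2009, Thm. 1.2] [cite: KochNadirashviliSereginSverak2009, Thms. 6.1–6.2] [cite: ChenStrainTsaiYau2009, Thm. 1.1] (the `C/|x'|` variant, SS Thm. 3.2 = Thm. 1.2 on the unit cylinder, has a conditional formal assembly `Literature.Analysis.FluidPDE.SereginSverak2009.isRegularAtOrigin_of_axisDecay` from the named facts of `SereginSverakAxisDecay.lean` [cite: SereginSverak2009, Thm. 3.2, Lemma 3.6 and §4]), and KNSS Thm. 6.2 carries an extra decay hypothesis (its assumption (2)); (b) "Type I" means the scale-invariant POINTWISE rate `|u| ≤ C(T-t)^{-1/2}` near the point — blow-up of axisymmetric solutions at faster (Type II) rates, or Type I scenarios without axial symmetry, are not addressed [cite: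 KochNadirashviliSereginSverak2009, §1] [cite: SereginSverak2009, §1]; (c) the conclusion is one-sided in time (essential boundedness on `]-r²,0[ × B_r`), matching the printed notion of regular point, not the tree's two-sided `Fluid.IsRegularPoint`; `ν = 1` as printed (general `ν` by scaling, not formalised).
status: established -/
def AxisymmetricTypeIExclusion : Prop :=
  ∀ (u : ℝ → ℝ³ → ℝ³) (p : ℝ → ℝ³ → ℝ),
    Literature.Analysis.FluidPDE.IsDistributionalNSSolutionOn ssCylinderOpens 1 0 u p →
    (∫⁻ z in ssCylinder, ‖u z.1 z.2‖ₑ ^ (3 : ℕ) < ∞) →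
    (∫⁻ z in ssCylinder, ‖p z.1 z.2‖ₑ ^ (3 / 2 : ℝ) < ∞) →
    (∀ t ∈ Ioo (-1 : ℝ) 0, Literature.Analysis.FluidPDE.IsAxisymmetric (u t)) →
    (∃ C : ℝ, ∀ᵐ z ∂(volume.restrict ssCylinder), Real.sqrt (-z.1) * ‖u z.1 z.2‖ ≤ C) →
    ∃ r > 0, eLpNorm (uncurry u) ∞ (volume.restrict (Literature.Analysis.FluidPDE.parabolicCylinder r (0, 0))) < ∞

/-- Reformulation as a non-existence statement (KNSS 2009, §1: axisymmetric singularities are of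
Type II): there is no distributional solution in the unit cylinder with the integrability,
axisymmetry and Type I hypotheses of `AxisymmetricTypeIExclusion` for which the origin is
singular (essentially unbounded on every backward parabolic cylinder about it). Proved from the
barrier fact. [cite: SereginSverak2009, Thm. 3.1 (= Thm. 1.1)] -/
theorem AxisymmetricTypeIExclusion.no_typeI_singularity (h : AxisymmetricTypeIExclusion) :
    ¬ ∃ (u : ℝ → ℝ³ → ℝ³) (p : ℝ → ℝ³ → ℝ),
      Literature.Analysis.FluidPDE.IsDistributionalNSSolutionOn ssCylinderOpens 1 0 u p ∧
      (∫⁻ z in ssCylinder, ‖u z.1 z.2‖ₑ ^ (3 : ℕ) < ∞) ∧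
      (∫⁻ z in ssCylinder, ‖p z.1 z.2‖ₑ ^ (3 / 2 : ℝ) < ∞) ∧
      (∀ t ∈ Ioo (-1 : ℝ) 0, Literature.Analysis.FluidPDE.IsAxisymmetric (u t)) ∧
      (∃ C : ℝ, ∀ᵐ z ∂(volume.restrict ssCylinder), Real.sqrt (-z.1) * ‖u z.1 z.2‖ ≤ C) ∧
      ∀ r > 0, eLpNorm (uncurry u) ∞ (volume.restrict (Literature.Analysis.FluidPDE.parabolicCylinder r (0, 0))) = ∞ := by
  rintro ⟨u, p, hsol, hu3, hp, haxi, htypeI, hsing⟩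
  obtain ⟨r, hr, hbdd⟩ := h u p hsol hu3 hp haxi htypeI
  exact hbdd.ne (hsing r hr)

end Literature.Barriers.NavierStokesRegularity
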